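import Summits.ValiantsHypothesis.ValiantsHypothesis.Theorems.SymPencilKernelFixedRank
import Literature.Computability.AlgebraicComplexity.DeterminantalConormalBoundProofs

/-!
# Route `SymPencil` — nondegenerate Hessian at `N = m` variables forces `rank A₀ ≤ 2`
# (the general theorem behind the crux `SdcPerBeyondN`, stmt-ValiantsHypothesis-5676)

`rank_constPart_le_two`: `k` of characteristic `0`, `f ∈ k[σ]` homogeneous of degree `n ≥ 2`,
`A = A₀ + Σ_v X_v A_v` a SYMMETRIC affine determinantal representation of `f` of size
`m = |ι| = |σ| ≠ n`, `x ≠ 0` a zero of `f` with `rank A(x) ≥ m - 1` and NONDEGENERATE Hessian.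
Then `rank A₀ ≤ 2`.  Proof: with `Y = A(x)`, `Y w = 0`, the kernel-row map `Φ : y ↦ M(y) w` has
rank `m - 1` (`SymPencilKernelRowRank` and non-surjectivity from
`SymPencilHomogeneousHessianRank`), so `ker Φ ∋ d ≠ 0`; the two-sided vanishing lemma gives
`Hess f (x) d = κ γ` (`γ_v = wᵀ A_v w`), Jacobi with `adj Y = c₀ w wᵀ` gives `∇ f (x) = c₀ γ`,
Euler gives `Hess f (x) x = (n-1) ∇ f (x)`, and nondegeneracy forces `d ∥ x`, hence `A₀ w = 0`
(the kernel is fixed along the cone line); then `SymPencilKernelFixedRank.rank_le_two_of_kernelRow`.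
For the permanent see `SymPencilSdcPerBeyondN.lean`. [folklore]
-/

noncomputable section

-- single-conjunct layout: Sub = Summit, duplicated namespace component intended
set_option linter.dupNamespace false

namespace Summit.ValiantsHypothesis.ValiantsHypothesis.Theorems.SymPencilHomogeneousConeKernel

open Matrix MvPolynomial
open Literature.Computability.AlgebraicComplexity
open Summit.ValiantsHypothesis.ValiantsHypothesis.Theorems.SymPencilHomogeneousHessianRank
open Summit.ValiantsHypothesis.ValiantsHypothesis.Theorems.SymPencilKernelRowRank
open Summit.ValiantsHypothesis.ValiantsHypothesis.Theorems.SymPencilKernelFixedRank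

universe u

variable {k : Type u} [Field k]

/-! ### Two linear-algebra tools -/

section Tools

variable {ι : Type*} [Fintype ι] [DecidableEq ι]

/-- A vector orthogonal to the kernel of the functional `γ ⬝ ·` is a multiple of `γ`. [folklore] -/
theorem exists_eq_smul_of_forall_dotProduct (h γ : ι → k)
    (hh : ∀ y : ι → k, γ ⬝ᵥ y = 0 → h ⬝ᵥ y = 0) : ∃ κ : k, h = κ • γ := by
  by_cases hγ : γ = 0
  · refine ⟨0, ?_⟩
    rw [zero_smul]
    ext i
    have := hh (Pi.single i 1) (by rw [hγ, zero_dotProduct])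
    rwa [dotProduct_single_one] at this
  obtain ⟨i₀, hi₀⟩ : ∃ i, γ i ≠ 0 := Function.ne_iff.mp hγ
  set z : ι → k := (γ i₀)⁻¹ • Pi.single i₀ 1 with hz
  have hγz : γ ⬝ᵥ z = 1 := by
    rw [hz, dotProduct_smul, dotProduct_single_one, smul_eq_mul, inv_mul_cancel₀ hi₀]
  refine ⟨h ⬝ᵥ z, ?_⟩
  ext i
  have hy := hh (Pi.single i 1 - γ i • z)
    (by rw [dotProduct_sub, dotProduct_smul, hγz, dotProduct_single_one, smul_eq_mul, mul_one,
      sub_self])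
  rw [dotProduct_sub, dotProduct_smul, dotProduct_single_one, smul_eq_mul, sub_eq_zero] at hy
  rw [hy, Pi.smul_apply, smul_eq_mul, mul_comm]

/-- **Adjugate of a symmetric corank-one matrix**: if `Y` is symmetric, `Y w = 0`, `w ≠ 0` and
`rank Y ≥ |ι| - 1`, then `adj Y = c₀ • w wᵀ`. [folklore] -/
theorem adjugate_eq_smul_vecMulVec {Y : Matrix ι ι k} (hYs : Yᵀ = Y) {w : ι → k} (hw : w ≠ 0)
    (hYw : Y *ᵥ w = 0) (hrank : Fintype.card ι ≤ Y.rank + 1) :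
    ∃ c₀ : k, Y.adjugate = c₀ • Matrix.vecMulVec w w := by
  have hdet : Y.det = 0 := Matrix.exists_mulVec_eq_zero_iff.1 ⟨w, hw, hYw⟩
  -- the kernel of `Y` is the line `k w`
  have hker : ∀ v : ι → k, Y *ᵥ v = 0 → ∃ c : k, v = c • w := by
    intro v hv
    have hfin : Module.finrank k (LinearMap.ker Y.mulVecLin) ≤ 1 := by
      have h := LinearMap.finrank_range_add_finrank_ker Y.mulVecLin
      rw [Module.finrank_fintype_fun_eq_card] at h
      change Y.rank + _ = _ at h
      omega
    have hwk : w ∈ LinearMap.ker Y.mulVecLin := by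
      rw [LinearMap.mem_ker, Matrix.mulVecLin_apply, hYw]
    have hvk : v ∈ LinearMap.ker Y.mulVecLin := by
      rw [LinearMap.mem_ker, Matrix.mulVecLin_apply, hv]
    have hle : Submodule.span k ({w} : Set (ι → k)) ≤ LinearMap.ker Y.mulVecLin :=
      Submodule.span_le.2 (Set.singleton_subset_iff.2 hwk)
    have heq : Submodule.span k ({w} : Set (ι → k)) = LinearMap.ker Y.mulVecLin :=
      Submodule.eq_of_le_of_finrank_le hle (by rw [finrank_span_singleton hw]; exact hfin)
    rw [← heq, Submodule.mem_span_singleton] at hvk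
    obtain ⟨c, hc⟩ := hvk
    exact ⟨c, hc.symm⟩
  -- every column of `adj Y` is in the kernel
  have hcol : ∀ j, ∃ c : k, (fun i => Y.adjugate i j) = c • w := by
    intro j
    apply hker
    ext i
    have h := congr_fun (congr_fun (Matrix.mul_adjugate Y) i) j
    rw [hdet, zero_smul, Matrix.zero_apply, Matrix.mul_apply] at h
    simpa [Matrix.mulVec, dotProduct] using h
  choose c hc using hcol
  have hadj : Y.adjugate = Matrix.vecMulVec w c := by
    ext i j
    have h := congr_fun (hc j) i
    simp only [Pi.smul_apply, smul_eq_mul] at h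
    rw [h, Matrix.vecMulVec_apply, mul_comm]
  -- symmetry of `adj Y` forces `c ∥ w`
  have hsym : (Y.adjugate)ᵀ = Y.adjugate := by rw [Matrix.adjugate_transpose, hYs]
  obtain ⟨i₀, hi₀⟩ : ∃ i, w i ≠ 0 := Function.ne_iff.mp hw
  refine ⟨c i₀ / w i₀, ?_⟩
  rw [hadj]
  ext i j
  have h := congr_fun (congr_fun hsym i₀) j
  rw [Matrix.transpose_apply, hadj, Matrix.vecMulVec_apply, Matrix.vecMulVec_apply] at h
  simp only [Matrix.vecMulVec_apply, Matrix.smul_apply, smul_eq_mul]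
  field_simp
  linear_combination (-(w i)) * h

end Tools

/-! ### The cone-kernel theorem -/

section Main

variable [CharZero k]

/-- **Nondegenerate Hessian forces `rank A₀ ≤ 2`.**  For `f` homogeneous of degree `n ≥ 2` with a
symmetric affine determinantal representation `A` of size `|ι| = |σ| ≠ n` (`n ≤ |ι|`) and a zero
`x ≠ 0` of `f` with `rank A(x) ≥ |ι| - 1` and NONDEGENERATE Hessian, the constant part `A₀` has
rank `≤ 2`. [folklore] -/
theorem rank_constPart_le_two {σ : Type*} [Fintype σ] [DecidableEq σ]
    {ι : Type*} [Fintype ι] [DecidableEq ι] {f : MvPolynomial σ k} {n : ℕ}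
    (hf : f.IsHomogeneous n) (hn : 2 ≤ n) {A : Matrix ι ι (MvPolynomial σ k)} (hAs : A.IsSymm)
    (hA : IsAffineDetRepr f A) (x : σ → k) (hx : eval x f = 0) (hx0 : x ≠ 0)
    (hHess : (hessianMatrix f x).rank = Fintype.card σ)
    (hcork : Fintype.card ι ≤ (A.map (eval x)).rank + 1) (hN : Fintype.card σ = Fintype.card ι)
    (hnm : n ≤ Fintype.card ι) (hne : Fintype.card ι ≠ n) : (constPart A).rank ≤ 2 := by
  classical
  obtain ⟨hdeg, hdet⟩ := hA
  -- the affine chain rule `Hess f (x) = Lᵀ · Hess DET (Y) · L`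
  have hfa : f = aeval (fun p : ι × ι => A p.1 p.2) (detPoly ι k) := by
    rw [detPoly, AlgHom.map_det, mvPolynomialX_mapMatrix_aeval k A, hdet]
  have hφ : ∀ (t : ι × ι) (u v : σ), pderiv u (pderiv v (A t.1 t.2)) = 0 := fun t u v =>
    pderiv_pderiv_eq_zero_of_totalDegree_le_one (hdeg t.1 t.2) u v
  set Y : Matrix ι ι k := Matrix.of fun i j => eval x (A i j) with hYdef
  have hYA : A.map (eval x) = Y := by ext i j; rfl
  have hYdet : Y.det = 0 := by
    have hmap : (MvPolynomial.eval x).mapMatrix A = Y := by ext i j; rfl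
    rw [← hmap, ← RingHom.map_det, hdet, hx]
  have hYs : Y.IsSymm := Matrix.IsSymm.ext fun i j => by
    simp only [hYdef, of_apply, hAs.apply i j]
  obtain ⟨w, hw, hwY⟩ := Matrix.exists_mulVec_eq_zero_iff.mpr hYdet
  have hwY' : w ᵥ* Y = 0 := by
    rw [← hYs.eq, vecMul_transpose, hwY]
  set L : Matrix (ι × ι) σ k := Matrix.of fun (t : ι × ι) (v : σ) => eval x (pderiv v (A t.1 t.2))
    with hLdef
  set Pw : Matrix ι (ι × ι) k := Matrix.of fun (j : ι) (q : ι × ι) => if q.2 = j then w q.1 else 0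
    with hPw
  have hHessL : hessianMatrix f x =
      Lᵀ * hessianMatrix (detPoly ι k) (fun t : ι × ι => eval x (A t.1 t.2)) * L := by
    conv_lhs => rw [hfa, hessianMatrix_aeval_of_affine _ hφ]
  have hbound : (hessianMatrix f x).rank ≤ (Pw * L).rank + 1 := by
    rw [hHessL]
    refine rank_transpose_mul_mul_le_rank_add_one _ w hw (fun Z Z' h1 h2 h3 => ?_) _
      (fun i j v => by simp only [hLdef, of_apply, hAs.apply i j])
    exact Summit.ValiantsHypothesis.Theorems.dotProduct_hessianMatrix_detPoly_mulVec_eq_zero_of_two_sided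
      Y (Matrix.of fun i j => Z (i, j)) (Matrix.of fun i j => Z' (i, j)) w hw hwY' hwY h1 h2 h3
  -- the pencil `A = A₀ + Σ_v X_v A_v`
  set A₀ : Matrix ι ι k := constPart A with hA₀
  let Mlin : (σ → k) →ₗ[k] Matrix ι ι k :=
    { toFun := fun z => ∑ v, z v • LRPencil.coeffMat A v
      map_add' := fun z₁ z₂ => by
        simp only [Pi.add_apply, add_smul, Finset.sum_add_distrib]
      map_smul' := fun c z => by
        simp only [Pi.smul_apply, smul_eq_mul, mul_smul, Finset.smul_sum, RingHom.id_apply] }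
  have hMlin : ∀ z, Mlin z = ∑ v, z v • LRPencil.coeffMat A v := fun z => rfl
  have hAz : ∀ z, A.map (eval z) = A₀ + Mlin z := fun z => by
    rw [hMlin, hA₀]
    exact LRPencil.map_eval_eq A hdeg z
  have hdetz : ∀ z, (A₀ + Mlin z).det = eval z f := fun z => by
    rw [← hAz, ← RingHom.mapMatrix_apply, ← RingHom.map_det, hdet]
  have hY : Y = A₀ + Mlin x := by rw [← hYA, hAz]
  have hcoeffs : ∀ v, (LRPencil.coeffMat A v)ᵀ = LRPencil.coeffMat A v := fun v => by
    ext i j; simp only [transpose_apply, LRPencil.coeffMat_apply, hAs.apply i j]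
  have hA₀s : A₀ᵀ = A₀ := by
    ext i j; simp only [hA₀, transpose_apply, constPart_apply, hAs.apply i j]
  have hMs : ∀ z, (Mlin z)ᵀ = Mlin z := fun z => by
    rw [hMlin, Matrix.transpose_sum]
    exact Finset.sum_congr rfl fun v _ => by rw [Matrix.transpose_smul, hcoeffs]
  -- `(P_w L) y = M(y) w`
  have hPZ : ∀ Z : ι × ι → k, Pw *ᵥ Z = w ᵥ* (Matrix.of fun i j => Z (i, j)) := by
    intro Z
    ext j
    simp only [hPw, mulVec, dotProduct, of_apply, vecMul, ite_mul, zero_mul]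
    rw [Fintype.sum_prod_type]
    simp only [Finset.sum_ite_eq', Finset.mem_univ, if_true]
  have hLM : ∀ y : σ → k, (Matrix.of fun i j => (L *ᵥ y) (i, j)) = Mlin y := by
    intro y
    ext i j
    simp only [of_apply, mulVec, dotProduct, hLdef, hMlin, Matrix.sum_apply, Matrix.smul_apply,
      smul_eq_mul, LRPencil.coeffMat_apply, AlperBogartVelasco.pderiv_eq_C_coeff (hdeg i j),
      eval_C]
    exact Finset.sum_congr rfl fun v _ => mul_comm _ _
  have hPwL : ∀ y : σ → k, (Pw * L) *ᵥ y = Mlin y *ᵥ w := by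
    intro y
    rw [← Matrix.mulVec_mulVec, hPZ, hLM]
    conv_lhs => rw [← hMs y]
    rw [vecMul_transpose]
  -- the homogeneity identity
  obtain ⟨d', hd'⟩ : ∃ d', Fintype.card ι = d' + n := ⟨Fintype.card ι - n, by omega⟩
  have hHom : ∀ (y : σ → k) (ν : k), ν ≠ -1 →
      (Y + Mlin y + ν • A₀).det = (1 + ν) ^ d' * (Y + Mlin y).det := by
    intro y ν hν
    have h1 : (1 + ν : k) ≠ 0 := fun h => hν (by linear_combination h)
    have hmat : Y + Mlin y + ν • A₀ = (1 + ν) • (A₀ + Mlin ((1 + ν)⁻¹ • (x + y))) := by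
      rw [hY, map_smul, map_add, smul_add, smul_smul, mul_inv_cancel₀ h1, one_smul, add_smul,
        one_smul]
      abel
    have hYM : Y + Mlin y = A₀ + Mlin (x + y) := by rw [hY, map_add, add_assoc]
    rw [hmat, Matrix.det_smul, hdetz, eval_smul_of_isHomogeneous hf, hYM, hdetz, hd', pow_add,
      mul_assoc, ← mul_assoc ((1 + ν) ^ n), ← mul_pow, mul_inv_cancel₀ h1, one_pow, one_mul]
  -- (1) the kernel-row map has rank exactly `m - 1`, hence a nontrivial kernel
  have hnotsurj : (Pw * L).rank + 1 ≤ Fintype.card ι := by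
    by_contra hlt
    have hr : (Pw * L).rank = Fintype.card ι :=
      le_antisymm (Matrix.rank_le_card_height _) (by omega)
    have hsurj : ∀ u : ι → k, ∃ y : σ → k, (Pw * L) *ᵥ y = u := by
      intro u
      have htop : LinearMap.range (Pw * L).mulVecLin = ⊤ := by
        apply Submodule.eq_top_of_finrank_eq
        rw [Module.finrank_fintype_fun_eq_card]
        exact hr
      have hu : u ∈ LinearMap.range (Pw * L).mulVecLin := htop ▸ Submodule.mem_top
      obtain ⟨y, hy⟩ := hu
      exact ⟨y, hy⟩
    have hj := eq_zero_of_kernelRow_surjective Y A₀ hYs.eq hA₀s w hw hwY (by rwa [hYA] at hcork)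
      Mlin hMs d' hHom fun u => by
        obtain ⟨y, hy⟩ := hsurj u
        exact ⟨y, by rw [← hPwL, hy]⟩
    omega
  have hrkPL : (Pw * L).rank + 1 = Fintype.card ι := by
    have h := hbound
    rw [hHess, hN] at h
    omega
  obtain ⟨d, hdker, hd0⟩ : ∃ d : σ → k, Mlin d *ᵥ w = 0 ∧ d ≠ 0 := by
    have hker : LinearMap.ker (Pw * L).mulVecLin ≠ ⊥ := by
      intro hbot
      have h := LinearMap.finrank_range_add_finrank_ker (Pw * L).mulVecLin
      rw [hbot, finrank_bot, Module.finrank_fintype_fun_eq_card, add_zero] at h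
      change (Pw * L).rank = _ at h
      omega
    obtain ⟨d, hd, hd0⟩ := Submodule.exists_mem_ne_zero_of_ne_bot hker
    refine ⟨d, ?_, hd0⟩
    rw [← hPwL]
    exact hd
  -- (2a) `Hess f (x) d ⊥ {y : wᵀ M(y) w = 0}`
  set γ : σ → k := fun v => w ⬝ᵥ LRPencil.coeffMat A v *ᵥ w with hγ
  have hγy : ∀ y : σ → k, γ ⬝ᵥ y = w ⬝ᵥ Mlin y *ᵥ w := by
    intro y
    simp only [hγ, dotProduct, Matrix.mulVec, hMlin, Matrix.sum_apply, Matrix.smul_apply,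
      smul_eq_mul, Finset.sum_mul, Finset.mul_sum]
    rw [Finset.sum_comm]
    refine Finset.sum_congr rfl fun i _ => ?_
    rw [Finset.sum_comm]
    exact Finset.sum_congr rfl fun j _ => Finset.sum_congr rfl fun v _ => by ring
  have hvan : ∀ y : σ → k, γ ⬝ᵥ y = 0 → (hessianMatrix f x *ᵥ d) ⬝ᵥ y = 0 := by
    intro y hy
    rw [hγy] at hy
    rw [hHessL, ← Matrix.mulVec_mulVec, ← Matrix.mulVec_mulVec, dotProduct_comm,
      Matrix.dotProduct_mulVec, vecMul_transpose]
    have hsymZ : ∀ Z Z' : ι × ι → k, Z ⬝ᵥ hessianMatrix (detPoly ι k)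
        (fun t : ι × ι => eval x (A t.1 t.2)) *ᵥ Z' =
        Z' ⬝ᵥ hessianMatrix (detPoly ι k) (fun t : ι × ι => eval x (A t.1 t.2)) *ᵥ Z := by
      intro Z Z'
      rw [Matrix.dotProduct_mulVec, ← Matrix.mulVec_transpose, hessianMatrix_transpose,
        dotProduct_comm]
    rw [hsymZ]
    refine Summit.ValiantsHypothesis.Theorems.dotProduct_hessianMatrix_detPoly_mulVec_eq_zero_of_two_sided
      Y (Matrix.of fun i j => (L *ᵥ d) (i, j)) (Matrix.of fun i j => (L *ᵥ y) (i, j)) w hw hwY'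
      hwY ?_ ?_ ?_
    · rw [hLM]
      conv_lhs => rw [← hMs d]
      rw [vecMul_transpose, hdker]
    · rw [hLM, hdker]
    · rw [hLM, hy]
  obtain ⟨κ, hκ⟩ := exists_eq_smul_of_forall_dotProduct _ γ hvan
  -- (2b) Jacobi: `∇ f (x) = c₀ γ`
  obtain ⟨c₀, hc₀⟩ := adjugate_eq_smul_vecMulVec hYs.eq hw hwY (by rwa [hYA] at hcork)
  set g : σ → k := fun v => eval x (pderiv v f) with hg
  have hgγ : g = c₀ • γ := by
    ext v
    simp only [hg, Pi.smul_apply, smul_eq_mul, hγ]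
    rw [← hdet, DeterminantalConormal.eval_pderiv_det, hYA, hc₀]
    have hcoe : A.map (fun p => eval x (pderiv v p)) = LRPencil.coeffMat A v := by
      ext i j
      simp only [Matrix.map_apply, LRPencil.coeffMat_apply,
        AlperBogartVelasco.pderiv_eq_C_coeff (hdeg i j), eval_C]
    rw [hcoe, Matrix.smul_mul, Matrix.trace_smul, Matrix.vecMulVec_mul, Matrix.trace_vecMulVec,
      smul_eq_mul, ← Matrix.mulVec_transpose, hcoeffs]
  -- (2c) Euler: `Hess f (x) x = (n - 1) ∇ f (x)`
  have hEuler' : ∀ u, (hessianMatrix f x *ᵥ x) u = ((n - 1 : ℕ) : k) * g u := by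
    intro u
    have h := congr_arg (eval x) ((hf.pderiv (i := u)).sum_X_mul_pderiv)
    rw [map_sum, map_nsmul, nsmul_eq_mul] at h
    simp only [map_mul, eval_X] at h
    simp only [mulVec, dotProduct, hessianMatrix_apply, hg]
    rw [← h]
    exact Finset.sum_congr rfl fun v _ => by rw [pderiv_pderiv_comm, mul_comm]
  have hEuler : hessianMatrix f x *ᵥ x = ((n - 1 : ℕ) : k) • g := by
    ext u
    rw [hEuler' u, Pi.smul_apply, smul_eq_mul]
  -- (2d) nondegeneracy
  have hnondeg : ∀ z : σ → k, hessianMatrix f x *ᵥ z = 0 → z = 0 := by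
    intro z hz
    have hdetH : (hessianMatrix f x).det ≠ 0 := by
      intro h0
      have := Matrix.rank_lt_card_of_det_eq_zero h0
      omega
    exact Matrix.eq_zero_of_mulVec_eq_zero hdetH hz
  have hn1 : ((n - 1 : ℕ) : k) ≠ 0 := by
    exact_mod_cast (show n - 1 ≠ 0 by omega)
  have hg0 : g ≠ 0 := by
    intro h0
    exact hx0 (hnondeg _ (by rw [hEuler, h0, smul_zero]))
  have hc₀0 : c₀ ≠ 0 := by
    rintro rfl
    exact hg0 (by rw [hgγ, zero_smul])
  -- (2e) `d ∥ x`, so the kernel is fixed along the cone line: `A₀ w = 0`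
  have hpar : κ • x = (((n - 1 : ℕ) : k) * c₀) • d := by
    have hz : hessianMatrix f x *ᵥ (κ • x - (((n - 1 : ℕ) : k) * c₀) • d) = 0 := by
      rw [Matrix.mulVec_sub, Matrix.mulVec_smul, Matrix.mulVec_smul, hEuler, hκ, hgγ]
      ext u
      simp only [Pi.sub_apply, Pi.smul_apply, smul_eq_mul, Pi.zero_apply]
      ring
    exact sub_eq_zero.1 (hnondeg _ hz)
  have hκ0 : κ ≠ 0 := by
    intro h0
    rw [h0, zero_smul] at hpar
    exact hd0 ((smul_eq_zero.1 hpar.symm).resolve_left (mul_ne_zero hn1 hc₀0))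
  have hMxw : Mlin x *ᵥ w = 0 := by
    have h := congr_arg (fun z => Mlin z *ᵥ w) hpar
    simp only [map_smul, Matrix.smul_mulVec, hdker, smul_zero] at h
    exact (smul_eq_zero.1 h).resolve_left hκ0
  have hA₀w : A₀ *ᵥ w = 0 := by
    have h := hwY
    rw [hY, Matrix.add_mulVec, hMxw, add_zero] at h
    exact h
  -- (3) the image of the kernel-row map is a hyperplane; apply the kernel-fixed bridge
  have h1 : ∃ y : σ → k, w ⬝ᵥ Mlin y *ᵥ w ≠ 0 := by
    have hγ0 : γ ≠ 0 := by
      rintro h0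
      exact hg0 (by rw [hgγ, h0, smul_zero])
    obtain ⟨v, hv⟩ : ∃ v, γ v ≠ 0 := Function.ne_iff.mp hγ0
    exact ⟨Pi.single v 1, by rwa [← hγy, dotProduct_single_one]⟩
  have hS : ∃ Λ : ι → k, ∀ z : ι → k, Λ ⬝ᵥ z = 0 → ∃ y : σ → k, Mlin y *ᵥ w = z := by
    set R := LinearMap.range (Pw * L).mulVecLin with hR
    by_cases htop : R = ⊤
    · refine ⟨0, fun z _ => ?_⟩
      have hz : z ∈ R := htop ▸ Submodule.mem_top
      obtain ⟨y, hy⟩ := hz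
      exact ⟨y, by rw [← hPwL]; exact hy⟩
    obtain ⟨φ, hφ0, hRφ⟩ := Submodule.exists_le_ker_of_lt_top R (lt_top_iff_ne_top.2 htop)
    -- `R = ker φ` by dimension count
    have hφsurj : LinearMap.range φ = ⊤ := by
      obtain ⟨v, hv⟩ : ∃ v, φ v ≠ 0 := by
        by_contra h
        push Not at h
        exact hφ0 (LinearMap.ext h)
      rw [eq_top_iff]
      rintro a -
      exact ⟨(a * (φ v)⁻¹) • v, by rw [map_smul, smul_eq_mul, mul_assoc, inv_mul_cancel₀ hv, mul_one]⟩
    have hkerdim : Module.finrank k (LinearMap.ker φ) + 1 = Fintype.card ι := by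
      have h := LinearMap.finrank_range_add_finrank_ker φ
      rw [hφsurj, finrank_top, Module.finrank_self, Module.finrank_fintype_fun_eq_card] at h
      omega
    have hReq : R = LinearMap.ker φ := by
      refine Submodule.eq_of_le_of_finrank_eq hRφ ?_
      have hRr : Module.finrank k R = (Pw * L).rank := rfl
      omega
    refine ⟨fun i => φ (Pi.single i 1), fun z hz => ?_⟩
    have hφz : φ z = 0 := by
      have hsingle : ∀ i : ι, (fun j : ι => if i = j then (1 : k) else 0) = Pi.single i 1 :=
        fun i => by ext j; simp [Pi.single_apply, eq_comm]
      rw [LinearMap.pi_apply_eq_sum_univ φ z]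
      simp_rw [hsingle]
      rw [dotProduct] at hz
      rw [← hz]
      exact Finset.sum_congr rfl fun i _ => by rw [smul_eq_mul, mul_comm]
    have hzR : z ∈ R := by
      rw [hReq, LinearMap.mem_ker]
      exact hφz
    obtain ⟨y, hy⟩ := hzR
    exact ⟨y, by rw [← hPwL]; exact hy⟩
  exact rank_le_two_of_kernelRow Y A₀ hYs.eq hA₀s w hw hwY hA₀w (by rwa [hYA] at hcork) Mlin hMs
    d' hHom h1 hS

end Main

end Summit.ValiantsHypothesis.ValiantsHypothesis.Theorems.SymPencilHomogeneousConeKernel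

end
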